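import Literature.MathematicalPhysics.QuantumFieldTheory.QCDTorusAxisPermutation
import Literature.MathematicalPhysics.QuantumFieldTheory.QCDTimeReflectionProofs
import Literature.MathematicalPhysics.QuantumFieldTheory.WilsonAxisSymmetry
import HarnessLib

/-!
# Axis permutations of gauge-invariant local lattice-QCD observables, and the lattice gap along every axis

Topic `MathematicalPhysics/QuantumFieldTheory` (families `constructive-qft`, `yang-mills`); sequel of
`QCDTorusAxisPermutation` (the honest functional `qcdTorusExpect` is covariant under `(π, S)` for every spinor
intertwiner `(S, S')` of the axis permutation `π`: `qcdTorusExpect_quarkAxisPerm`) and of `QCDTimeReflectionProofs`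
(the placing map `placeLin` behind `QCDLatticeObservable.onTorus`).

* `boxSitePerm`, `boxAxisLin π S S'`, `boxAxisPerm` — the axis permutation on the BOXED quark Grassmann algebra
  (`ψ̄_{f,x,a,·} ↦ ψ̄_{f,πx,a,·} S`, `ψ_{f,x,a,·} ↦ S' ψ_{f,πx,a,·}`); its basis formulas; it intertwines the gauge
  action (`fermiGaugeLin_comp_boxAxisLin`, `fermiGaugeAct_boxAxisPerm`);
* `QCDLatticeObservable.axisPerm A π S S'` — **the permuted observable** `U ↦ (π,S)·(A(π⁻¹·U))`, again a
  gauge-invariant local observable (same quark box, permuted link support);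
* `QCDLatticeObservable.axisPerm_onTorus` — placing the permuted observable at `π v` on the permuted torus field is
  permuting the placed observable: `(A.axisPerm π S S').onTorus T (π v) (π·U) = quarkAxisPerm π S S' (A.onTorus T v U)`;
* `qcdTorusExpect_axisPerm_onTorus(_mul)` — one- and two-point functions of permuted observables at permuted sites
  equal those of the original observables;
* `QCDScheme.HasLatticeMassGap.along_axis` — **the uniform lattice mass gap of `QCDOS` (stated in the Euclidean-TIME
  direction) holds along every coordinate axis**, with the same rate, for every pair of observables (apply the clause to
  the pair of permuted observables for the transposition `(0 i)` and transport by covariance).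

This is the observable-level half of the hypercubic-covariance input (M4) named by the audits of items
AnomalyRigidity.UniformGapTreeDecay and HeatSlicedQuarks.RobustYangMillsHandover.
References: Montvay–Münster 1994 §4.2, §5.1 [MontvayMunster1994]; Osterwalder–Seiler 1978 §2 [OsterwalderSeiler1978].
-/

noncomputable section

open MeasureTheory
open Literature.MathematicalPhysics.QuantumLattice Literature.Probability.LatticeModels GrassmannAlgebra
open scoped Matrix

namespace Literature.MathematicalPhysics.QuantumFieldTheory

variable {Nf R : ℕ}

local notation "𝔾" => Matrix.specialUnitaryGroup (Fin 3) ℂ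

/-! ### The axis permutation on the boxed quark algebra -/

/-- The axis permutation of a boxed site (the cube `{−R,…,R}⁴` is permutation invariant). [folklore] -/
def boxSitePerm (π : Equiv.Perm (Fin 4)) (x : ↥(box 4 R)) : ↥(box 4 R) :=
  ⟨sitePermZd π (x : _root_.Literature.Probability.LatticeModels.Site 4),
    (sitePermZd_mem_box_iff π R _).2 x.2⟩

/-- Underlying site of the permuted boxed site. [folklore] -/
@[simp] theorem coe_boxSitePerm (π : Equiv.Perm (Fin 4)) (x : ↥(box 4 R)) :
    ((boxSitePerm π x : ↥(box 4 R)) : _root_.Literature.Probability.LatticeModels.Site 4) =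
      sitePermZd π (x : _root_.Literature.Probability.LatticeModels.Site 4) := rfl

/-- `π⁻¹` undoes `π` on boxed sites. [folklore] -/
@[simp] theorem boxSitePerm_symm_apply (π : Equiv.Perm (Fin 4)) (x : ↥(box 4 R)) :
    boxSitePerm π.symm (boxSitePerm π x) = x :=
  Subtype.ext (sitePermZd_symm_apply_apply π _)

/-- `π` undoes `π⁻¹` on boxed sites. [folklore] -/
@[simp] theorem boxSitePerm_apply_symm (π : Equiv.Perm (Fin 4)) (x : ↥(box 4 R)) :
    boxSitePerm π (boxSitePerm π.symm x) = x :=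
  Subtype.ext (sitePermZd_apply_symm_apply π _)

/-- `y = π x ↔ π⁻¹ y = x` on boxed sites. [folklore] -/
theorem eq_boxSitePerm_iff (π : Equiv.Perm (Fin 4)) {x y : ↥(box 4 R)} : y = boxSitePerm π x ↔ boxSitePerm π.symm y = x := by
  constructor
  · rintro rfl; exact boxSitePerm_symm_apply π x
  · rintro rfl; exact (boxSitePerm_apply_symm π y).symm

/-- **The coefficient map of the axis permutation `(π, S, S')` on boxed quark generators**:
`(L c)_{ψ̄,(f,y,a,β)} = ∑_α S_{βα} c_{ψ̄,(f,π⁻¹y,a,α)}`, `(L c)_{ψ,(f,y,a,β)} = ∑_α S'_{αβ} c_{ψ,(f,π⁻¹y,a,α)}` — so that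
`ψ̄_{f,x,a,α} ↦ ∑_β S_{βα} ψ̄_{f,πx,a,β}` and `ψ_{f,x,a,α} ↦ ∑_β S'_{αβ} ψ_{f,πx,a,β}`. [cite: MontvayMunster1994, §4.2 and §5.1] -/
def boxAxisLin (π : Equiv.Perm (Fin 4)) (S S' : Matrix (Fin 4) (Fin 4) ℂ) :
    ((BoxFermiIdx Nf R ⊕ₗ BoxFermiIdx Nf R) → ℂ) →ₗ[ℂ] ((BoxFermiIdx Nf R ⊕ₗ BoxFermiIdx Nf R) → ℂ) :=
  LinearMap.pi fun w =>
    match ofLex w with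
    | Sum.inl i =>
        let v := boxQuarkEquiv.symm i
        ∑ α : Fin 4, (S v.2.2.2 α) •
          LinearMap.proj (toLex (Sum.inl (boxQuarkEquiv (v.1, (boxSitePerm π.symm v.2.1, v.2.2.1, α)))))
    | Sum.inr i =>
        let v := boxQuarkEquiv.symm i
        ∑ α : Fin 4, (S' α v.2.2.2) •
          LinearMap.proj (toLex (Sum.inr (boxQuarkEquiv (v.1, (boxSitePerm π.symm v.2.1, v.2.2.1, α)))))

/-- The coefficient map on the basis vector of `ψ̄_{f,x,a,α}`:
`e_{ψ̄,(f,x,a,α)} ↦ ∑_β S_{βα} e_{ψ̄,(f,πx,a,β)}`. [cite: MontvayMunster1994, §4.2] -/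
theorem boxAxisLin_single_inl (π : Equiv.Perm (Fin 4)) (S S' : Matrix (Fin 4) (Fin 4) ℂ) (f : Fin Nf) (x : ↥(box 4 R))
    (a : Fin 3) (α : Fin 4) :
    boxAxisLin (Nf := Nf) (R := R) π S S' (Pi.single (toLex (Sum.inl (boxQuarkEquiv (f, (x, a, α))))) (1 : ℂ)) =
      ∑ β : Fin 4, S β α •
        Pi.single (toLex (Sum.inl (boxQuarkEquiv (Nf := Nf) (R := R) (f, (boxSitePerm π x, a, β))))) (1 : ℂ) := by
  funext w
  obtain ⟨y, rfl⟩ : ∃ y, toLex y = w := ⟨ofLex w, rfl⟩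
  rcases y with i | i
  · obtain ⟨⟨f', x', a', β'⟩, rfl⟩ := boxQuarkEquiv.surjective i
    simp only [boxAxisLin, LinearMap.pi_apply, ofLex_toLex, LinearMap.coe_sum, Finset.sum_apply,
      LinearMap.smul_apply, LinearMap.proj_apply, Equiv.symm_apply_apply, Pi.single_apply,
      Pi.smul_apply, smul_eq_mul, Sum.inl.injEq, EmbeddingLike.apply_eq_iff_eq, Prod.mk.injEq, mul_ite, mul_one,
      mul_zero]
    by_cases hf : f' = f
    · by_cases ha : a' = a
      · by_cases hx : boxSitePerm π.symm x' = x
        · subst hf ha hx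
          simp [Finset.sum_ite_eq', Finset.sum_ite_eq]
        · have hx' : ¬ x' = boxSitePerm π x := fun h => hx ((eq_boxSitePerm_iff π).1 h)
          simp [hx, hx']
      · simp [ha]
    · simp [hf]
  · simp only [boxAxisLin, LinearMap.pi_apply, ofLex_toLex, LinearMap.coe_sum, Finset.sum_apply,
      LinearMap.smul_apply, LinearMap.proj_apply, Pi.single_apply, Pi.smul_apply, smul_eq_mul,
      toLex_inj, reduceCtorEq, if_false, mul_zero, Finset.sum_const_zero]

/-- The coefficient map on the basis vector of `ψ_{f,x,a,α}`:
`e_{ψ,(f,x,a,α)} ↦ ∑_β S'_{αβ} e_{ψ,(f,πx,a,β)}`. [cite: MontvayMunster1994, §4.2] -/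
theorem boxAxisLin_single_inr (π : Equiv.Perm (Fin 4)) (S S' : Matrix (Fin 4) (Fin 4) ℂ) (f : Fin Nf) (x : ↥(box 4 R))
    (a : Fin 3) (α : Fin 4) :
    boxAxisLin (Nf := Nf) (R := R) π S S' (Pi.single (toLex (Sum.inr (boxQuarkEquiv (f, (x, a, α))))) (1 : ℂ)) =
      ∑ β : Fin 4, S' α β •
        Pi.single (toLex (Sum.inr (boxQuarkEquiv (Nf := Nf) (R := R) (f, (boxSitePerm π x, a, β))))) (1 : ℂ) := by
  funext w
  obtain ⟨y, rfl⟩ : ∃ y, toLex y = w := ⟨ofLex w, rfl⟩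
  rcases y with i | i
  · simp only [boxAxisLin, LinearMap.pi_apply, ofLex_toLex, LinearMap.coe_sum, Finset.sum_apply,
      LinearMap.smul_apply, LinearMap.proj_apply, Pi.single_apply, Pi.smul_apply, smul_eq_mul,
      toLex_inj, reduceCtorEq, if_false, mul_zero, Finset.sum_const_zero]
  · obtain ⟨⟨f', x', a', β'⟩, rfl⟩ := boxQuarkEquiv.surjective i
    simp only [boxAxisLin, LinearMap.pi_apply, ofLex_toLex, LinearMap.coe_sum, Finset.sum_apply,
      LinearMap.smul_apply, LinearMap.proj_apply, Equiv.symm_apply_apply, Pi.single_apply,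
      Pi.smul_apply, smul_eq_mul, Sum.inr.injEq, EmbeddingLike.apply_eq_iff_eq, Prod.mk.injEq, mul_ite, mul_one,
      mul_zero]
    by_cases hf : f' = f
    · by_cases ha : a' = a
      · by_cases hx : boxSitePerm π.symm x' = x
        · subst hf ha hx
          simp [Finset.sum_ite_eq', Finset.sum_ite_eq]
        · have hx' : ¬ x' = boxSitePerm π x := fun h => hx ((eq_boxSitePerm_iff π).1 h)
          simp [hx, hx']
      · simp [ha]
    · simp [hf]

variable (Nf R) in
/-- **The axis permutation `(π, S, S')` on the boxed quark Grassmann algebra** (an algebra endomorphism).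
[cite: MontvayMunster1994, §4.2 and §5.1] -/
def boxAxisPerm (π : Equiv.Perm (Fin 4)) (S S' : Matrix (Fin 4) (Fin 4) ℂ) : BoxFermiAlg Nf R →ₐ[ℂ] BoxFermiAlg Nf R :=
  ExteriorAlgebra.map (boxAxisLin (Nf := Nf) (R := R) π S S')

/-- **The coefficient map intertwines the gauge action**: `G_g ∘ L = L ∘ G_{g ∘ π}` (the gauge transformation
acts on the colour index at the site, the axis map on site and spin). [folklore] -/
theorem fermiGaugeLin_comp_boxAxisLin (π : Equiv.Perm (Fin 4)) (S S' : Matrix (Fin 4) (Fin 4) ℂ)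
    (g : _root_.Literature.Probability.LatticeModels.Site 4 → 𝔾) :
    fermiGaugeLin (Nf := Nf) (R := R) g ∘ₗ boxAxisLin π S S' =
      boxAxisLin π S S' ∘ₗ fermiGaugeLin (Nf := Nf) (R := R) (g ∘ sitePermZd π) := by
  refine LinearMap.ext fun c => funext fun w => ?_
  obtain ⟨x, rfl⟩ : ∃ x, toLex x = w := ⟨ofLex w, rfl⟩
  rcases x with i | i
  · simp only [LinearMap.comp_apply, fermiGaugeLin, boxAxisLin, LinearMap.pi_apply, ofLex_toLex, LinearMap.coe_sum,
      Finset.sum_apply, LinearMap.smul_apply, LinearMap.proj_apply, Equiv.symm_apply_apply, smul_eq_mul,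
      Finset.mul_sum, Function.comp_apply, coe_boxSitePerm, sitePermZd_apply_symm_apply]
    rw [Finset.sum_comm]
    refine Finset.sum_congr rfl fun a _ => Finset.sum_congr rfl fun α _ => ?_
    ring
  · simp only [LinearMap.comp_apply, fermiGaugeLin, boxAxisLin, LinearMap.pi_apply, ofLex_toLex, LinearMap.coe_sum,
      Finset.sum_apply, LinearMap.smul_apply, LinearMap.proj_apply, Equiv.symm_apply_apply, smul_eq_mul,
      Finset.mul_sum, Function.comp_apply, coe_boxSitePerm, sitePermZd_apply_symm_apply]
    rw [Finset.sum_comm]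
    refine Finset.sum_congr rfl fun a _ => Finset.sum_congr rfl fun α _ => ?_
    ring

/-- **The axis permutation intertwines the gauge action on the boxed algebra**: `g · (L y) = L ((g ∘ π) · y)`.
[cite: OsterwalderSeiler1978, §2] -/
theorem fermiGaugeAct_boxAxisPerm (π : Equiv.Perm (Fin 4)) (S S' : Matrix (Fin 4) (Fin 4) ℂ)
    (g : _root_.Literature.Probability.LatticeModels.Site 4 → 𝔾) (y : BoxFermiAlg Nf R) :
    fermiGaugeAct g (boxAxisPerm Nf R π S S' y) = boxAxisPerm Nf R π S S' (fermiGaugeAct (g ∘ sitePermZd π) y) := by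
  simp only [fermiGaugeAct, boxAxisPerm]
  rw [← AlgHom.comp_apply, ExteriorAlgebra.map_comp_map, fermiGaugeLin_comp_boxAxisLin, ← ExteriorAlgebra.map_comp_map,
    AlgHom.comp_apply]

/-- **Gauge covariance of the axis permutation of `ℤ⁴`-configurations**: `π·(U^g) = (π·U)^{g ∘ π⁻¹}`. [folklore] -/
theorem configPermZd_gaugeTransformZd {G : Type*} [Group G] [MeasurableSpace G] (π : Equiv.Perm (Fin 4))
    (g : _root_.Literature.Probability.LatticeModels.Site 4 → G) (U : LGConfig 4 G) :
    configPermZd π (gaugeTransformZd g U) = gaugeTransformZd (g ∘ sitePermZd π.symm) (configPermZd π U) := by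
  funext ⟨x, i⟩
  simp only [configPermZd_apply, gaugeTransformZd, Function.comp_apply, sitePermZd_add, sitePermZd_single]

/-- Expansion of an algebra endomorphism over the monomial basis: `Φ a = ∑_s a_s Φ(θ_s)`. [folklore] -/
theorem algHom_apply_eq_sum_coord (Φ : BoxFermiAlg Nf R →ₐ[ℂ] BoxFermiAlg Nf R) (a : BoxFermiAlg Nf R) :
    Φ a = ∑ s, ((GrassmannAlgebra.grassmannBasis ℂ (BoxFermiIdx Nf R ⊕ₗ BoxFermiIdx Nf R)).coord s a) •
      Φ (GrassmannAlgebra.grassmannBasis ℂ (BoxFermiIdx Nf R ⊕ₗ BoxFermiIdx Nf R) s) := by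
  conv_lhs => rw [← (GrassmannAlgebra.grassmannBasis ℂ (BoxFermiIdx Nf R ⊕ₗ BoxFermiIdx Nf R)).sum_repr a]
  simp only [map_sum, map_smul]
  rfl

namespace QCDLatticeObservable

/-- **The axis-permuted gauge-invariant local observable** `(π,S)·A`: `U ↦ (π,S,S')·(A(π⁻¹·U))` — the gauge field is
read through the permuted configuration `configPermZd π⁻¹ U`, and the resulting element of the boxed quark algebra is
transformed by `boxAxisPerm π S S'`.  Again a gauge-invariant local observable with the same quark box and permuted link
support. [cite: OsterwalderSeiler1978, §2] [cite: MontvayMunster1994, §4.2] -/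
def axisPerm (A : QCDLatticeObservable Nf R) (π : Equiv.Perm (Fin 4)) (S S' : Matrix (Fin 4) (Fin 4) ℂ) :
    QCDLatticeObservable Nf R where
  F U := boxAxisPerm Nf R π S S' (A.F (configPermZd π.symm U))
  supp := A.supp.image fun e => (sitePermZd π e.1, π e.2)
  isCylinder U V hUV := by
    change boxAxisPerm Nf R π S S' (A.F (configPermZd π.symm U)) = boxAxisPerm Nf R π S S' (A.F (configPermZd π.symm V))
    rw [A.isCylinder (fun e he => ?_)]
    have h := hUV (sitePermZd π e.1, π e.2) (Finset.mem_coe.2 (Finset.mem_image_of_mem _ he))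
    simp only [configPermZd_apply, Equiv.symm_symm] at h ⊢
    exact h
  gaugeInvariant g U := by
    rw [configPermZd_gaugeTransformZd, Equiv.symm_symm, fermiGaugeAct_boxAxisPerm, A.gaugeInvariant]
  bounded y := by
    classical
    choose ys hys using fun s =>
      exists_berezin_mul_eq_coord ℂ (ι := BoxFermiIdx Nf R ⊕ₗ BoxFermiIdx Nf R) s
    choose C hC using fun s => A.bounded (ys s)
    refine ⟨∑ s, C s * ‖GrassmannAlgebra.berezin ℂ (BoxFermiIdx Nf R ⊕ₗ BoxFermiIdx Nf R)
      (boxAxisPerm Nf R π S S' (GrassmannAlgebra.grassmannBasis ℂ _ s) * y)‖, fun U => ?_⟩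
    rw [algHom_apply_eq_sum_coord (boxAxisPerm Nf R π S S') (A.F (configPermZd π.symm U))]
    simp only [Finset.sum_mul, map_sum, smul_mul_assoc, map_smul, smul_eq_mul]
    refine (norm_sum_le _ _).trans (Finset.sum_le_sum fun s _ => ?_)
    rw [norm_mul, ← hys s]
    exact mul_le_mul_of_nonneg_right (hC s _) (norm_nonneg _)
  measurable y := by
    classical
    choose ys hys using fun s =>
      exists_berezin_mul_eq_coord ℂ (ι := BoxFermiIdx Nf R ⊕ₗ BoxFermiIdx Nf R) s
    have hrw : (fun U => GrassmannAlgebra.berezin ℂ (BoxFermiIdx Nf R ⊕ₗ BoxFermiIdx Nf R)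
        (boxAxisPerm Nf R π S S' (A.F (configPermZd π.symm U)) * y)) = fun U => ∑ s,
          GrassmannAlgebra.berezin ℂ _ (A.F (configPermZd π.symm U) * ys s) *
            GrassmannAlgebra.berezin ℂ _ (boxAxisPerm Nf R π S S' (GrassmannAlgebra.grassmannBasis ℂ _ s) * y) := by
      funext U
      rw [algHom_apply_eq_sum_coord (boxAxisPerm Nf R π S S') (A.F (configPermZd π.symm U))]
      simp only [Finset.sum_mul, map_sum, smul_mul_assoc, map_smul, smul_eq_mul, hys]
    rw [hrw]
    refine Finset.measurable_sum _ fun s _ => ?_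
    exact ((A.measurable (ys s)).comp (continuous_configPermZd π.symm).measurable).mul_const _

/-- The permuted observable, unfolded. [folklore] -/
@[simp] theorem axisPerm_F (A : QCDLatticeObservable Nf R) (π : Equiv.Perm (Fin 4)) (S S' : Matrix (Fin 4) (Fin 4) ℂ)
    (U : LGConfig 4 𝔾) :
    (A.axisPerm π S S').F U = boxAxisPerm Nf R π S S' (A.F (configPermZd π.symm U)) := rfl

end QCDLatticeObservable

/-! ### Placing on the torus commutes with the axis permutation -/

section Placing

variable {T : ℕ} [NeZero T]

omit [NeZero T] in
/-- Reduction mod `T` commutes with the axis permutations of `ℤ⁴` and of the torus. [folklore] -/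
theorem sitePerm_proj (π : Equiv.Perm (Fin 4)) (z : _root_.Literature.Probability.LatticeModels.Site 4) :
    sitePerm π (Torus.proj T z) = Torus.proj T (sitePermZd π z) := by
  funext j
  simp [sitePerm_apply, sitePermZd_apply, Torus.proj]

/-- A block sum against a spin block collapses to a spin sum (column form, general coefficients). [folklore] -/
theorem sum_spinBlock_col_smul {M' : Type*} [AddCommMonoid M'] [Module ℂ M'] (M : Matrix (Fin 4) (Fin 4) ℂ)
    (f : Fin Nf) (x : TorusSite 4 T) (a : Fin 3) (α : Fin 4) (g : FermiIdx Nf T → M') :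
    ∑ k, spinBlock M k (quarkEquiv (f, (x, a, α))) • g k = ∑ m : Fin 4, M m α • g (quarkEquiv (f, (x, a, m))) := by
  rw [← Equiv.sum_comp quarkEquiv]
  simp only [Fintype.sum_prod_type]
  rw [Finset.sum_eq_single f, Finset.sum_eq_single x, Finset.sum_eq_single a]
  · refine Finset.sum_congr rfl fun m _ => ?_
    rw [spinBlock_apply, if_pos ⟨rfl, rfl, rfl⟩]
  · intro a' _ ha'
    exact Finset.sum_eq_zero fun m _ => by rw [spinBlock_apply, if_neg (fun h => ha' h.2.2), zero_smul]
  · exact fun h => absurd (Finset.mem_univ a) h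
  · intro x' _ hx'
    exact Finset.sum_eq_zero fun a' _ => Finset.sum_eq_zero fun m _ => by
      rw [spinBlock_apply, if_neg (fun h => hx' h.2.1), zero_smul]
  · exact fun h => absurd (Finset.mem_univ x) h
  · intro f' _ hf'
    exact Finset.sum_eq_zero fun x' _ => Finset.sum_eq_zero fun a' _ => Finset.sum_eq_zero fun m _ => by
      rw [spinBlock_apply, if_neg (fun h => hf' h.1), zero_smul]
  · exact fun h => absurd (Finset.mem_univ f) h

/-- A block sum against a spin block collapses to a spin sum (row form, general coefficients). [folklore] -/
theorem sum_spinBlock_row_smul {M' : Type*} [AddCommMonoid M'] [Module ℂ M'] (M : Matrix (Fin 4) (Fin 4) ℂ)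
    (f : Fin Nf) (x : TorusSite 4 T) (a : Fin 3) (α : Fin 4) (g : FermiIdx Nf T → M') :
    ∑ l, spinBlock M (quarkEquiv (f, (x, a, α))) l • g l = ∑ m : Fin 4, M α m • g (quarkEquiv (f, (x, a, m))) := by
  rw [← Equiv.sum_comp quarkEquiv]
  simp only [Fintype.sum_prod_type]
  rw [Finset.sum_eq_single f, Finset.sum_eq_single x, Finset.sum_eq_single a]
  · refine Finset.sum_congr rfl fun m _ => ?_
    rw [spinBlock_apply, if_pos ⟨rfl, rfl, rfl⟩]
  · intro a' _ ha'
    exact Finset.sum_eq_zero fun m _ => by rw [spinBlock_apply, if_neg (fun h => ha' h.2.2.symm), zero_smul]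
  · exact fun h => absurd (Finset.mem_univ a) h
  · intro x' _ hx'
    exact Finset.sum_eq_zero fun a' _ => Finset.sum_eq_zero fun m _ => by
      rw [spinBlock_apply, if_neg (fun h => hx' h.2.1.symm), zero_smul]
  · exact fun h => absurd (Finset.mem_univ x) h
  · intro f' _ hf'
    exact Finset.sum_eq_zero fun x' _ => Finset.sum_eq_zero fun a' _ => Finset.sum_eq_zero fun m _ => by
      rw [spinBlock_apply, if_neg (fun h => hf' h.1.symm), zero_smul]
  · exact fun h => absurd (Finset.mem_univ f) h

/-- The linear map behind `quarkAxisPerm` (site relabelling after the spin block substitution). [folklore] -/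
abbrev quarkAxisLin (Nf T : ℕ) [NeZero T] (π : Equiv.Perm (Fin 4)) (S S' : Matrix (Fin 4) (Fin 4) ℂ) :
    ((FermiIdx Nf T ⊕ₗ FermiIdx Nf T) → ℂ) →ₗ[ℂ] ((FermiIdx Nf T ⊕ₗ FermiIdx Nf T) → ℂ) :=
  LinearMap.funLeft ℂ ℂ
      (toLex.symm.trans ((Equiv.sumCongr (quarkSitePerm Nf π) (quarkSitePerm Nf π)).trans
        (toLex : FermiIdx Nf T ⊕ FermiIdx Nf T ≃ FermiIdx Nf T ⊕ₗ FermiIdx Nf T))).symm ∘ₗ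
    blockSubst ℂ (spinBlock (Nf := Nf) (L := T) S) (spinBlock (Nf := Nf) (L := T) S')ᵀ

/-- `quarkAxisPerm` is `Λ(quarkAxisLin)`. [folklore] -/
theorem quarkAxisPerm_eq_map (π : Equiv.Perm (Fin 4)) (S S' : Matrix (Fin 4) (Fin 4) ℂ) :
    quarkAxisPerm Nf (L := T) π S S' = ExteriorAlgebra.map (quarkAxisLin Nf T π S S') := by
  rw [quarkAxisPerm, ExteriorAlgebra.map_comp_map]

/-- **The placing map intertwines the two axis permutations** (box and torus):
`P_{π v} ∘ L_box = L_torus ∘ P_v` on coefficient vectors. [folklore] -/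
theorem placeLin_comp_boxAxisLin (π : Equiv.Perm (Fin 4)) (S S' : Matrix (Fin 4) (Fin 4) ℂ)
    (v : _root_.Literature.Probability.LatticeModels.Site 4) :
    placeLin Nf R T (sitePermZd π v) ∘ₗ boxAxisLin π S S' = quarkAxisLin Nf T π S S' ∘ₗ placeLin Nf R T v := by
  classical
  refine (Pi.basisFun ℂ _).ext fun w => ?_
  obtain ⟨y, rfl⟩ : ∃ y, toLex y = w := ⟨ofLex w, rfl⟩
  rcases y with i | i
  · obtain ⟨⟨f, x, a, α⟩, rfl⟩ := boxQuarkEquiv.surjective i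
    rw [Pi.basisFun_apply, LinearMap.comp_apply, LinearMap.comp_apply, boxAxisLin_single_inl, map_sum, placeLin_single]
    simp only [map_smul, placeLin_single, QCDLatticeObservable.toTorusIdx, ofLex_toLex, Equiv.symm_apply_apply,
      coe_boxSitePerm, LinearMap.comp_apply, blockSubst_single_inl, map_sum, funLeft_symm_single]
    rw [sum_spinBlock_col_smul]
    refine Finset.sum_congr rfl fun β _ => ?_
    congr 2
    change toLex (Sum.inl (quarkEquiv _)) = toLex (Sum.inl (quarkSitePerm Nf π (quarkEquiv _)))
    rw [quarkSitePerm_quarkEquiv, sitePerm_proj, sitePermZd_add]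
  · obtain ⟨⟨f, x, a, α⟩, rfl⟩ := boxQuarkEquiv.surjective i
    rw [Pi.basisFun_apply, LinearMap.comp_apply, LinearMap.comp_apply, boxAxisLin_single_inr, map_sum, placeLin_single]
    simp only [map_smul, placeLin_single, QCDLatticeObservable.toTorusIdx, ofLex_toLex, Equiv.symm_apply_apply,
      coe_boxSitePerm, LinearMap.comp_apply, blockSubst_single_inr, map_sum, funLeft_symm_single, Matrix.transpose_apply]
    rw [sum_spinBlock_row_smul]
    refine Finset.sum_congr rfl fun β _ => ?_
    congr 2
    change toLex (Sum.inr (quarkEquiv _)) = toLex (Sum.inr (quarkSitePerm Nf π (quarkEquiv _)))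
    rw [quarkSitePerm_quarkEquiv, sitePerm_proj, sitePermZd_add]

/-- **Placing the permuted observable at `π v` on the permuted torus field is permuting the placed observable**:
`(A.axisPerm π S S').onTorus T (π v) (π·U) = quarkAxisPerm π S S' (A.onTorus T v U)`. [cite: OsterwalderSeiler1978, §2] -/
theorem QCDLatticeObservable.axisPerm_onTorus (A : QCDLatticeObservable Nf R) (π : Equiv.Perm (Fin 4))
    (S S' : Matrix (Fin 4) (Fin 4) ℂ) (v : _root_.Literature.Probability.LatticeModels.Site 4) (U : GaugeConfig 4 T 𝔾) :
    (A.axisPerm π S S').onTorus T (sitePermZd π v) (configPerm π U) = quarkAxisPerm Nf π S S' (A.onTorus T v U) := by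
  unfold QCDLatticeObservable.onTorus
  rw [QCDLatticeObservable.axisPerm_F, configPermZd_configShift, sitePermZd_neg, sitePermZd_symm_apply_apply,
    configPermZd_torusLift, show configPerm π.symm (configPerm π U) = U by
      simpa only [Equiv.symm_symm] using configPerm_configPerm_symm (L := T) π.symm U,
    boxAxisPerm, ← AlgHom.comp_apply, ExteriorAlgebra.map_comp_map, quarkAxisPerm_eq_map, ← AlgHom.comp_apply,
    ExteriorAlgebra.map_comp_map, placeLin_comp_boxAxisLin]

end Placing

/-! ### Consequences for the honest functional: permuted observables at permuted sites -/

section Expectations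

variable {T : ℕ} [NeZero T]

/-- **One-point functions of permuted observables at permuted sites are the original ones.** [cite: OsterwalderSeiler1978, §2] -/
theorem qcdTorusExpect_axisPerm_onTorus {π : Equiv.Perm (Fin 4)} {S S' : Matrix (Fin 4) (Fin 4) ℂ}
    (hS : IsSpinorIntertwiner π S S') (β : ℝ) (mq : Fin Nf → ℝ) (A : QCDLatticeObservable Nf R)
    (v : _root_.Literature.Probability.LatticeModels.Site 4) :
    qcdTorusExpect β T mq (fun U => (A.axisPerm π S S').onTorus T (sitePermZd π v) U) =
      qcdTorusExpect β T mq (fun U => A.onTorus T v U) := by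
  have h : ∀ U : GaugeConfig 4 T 𝔾, (A.axisPerm π S S').onTorus T (sitePermZd π v) U =
      quarkAxisPerm Nf π S S' (A.onTorus T v (configPerm π.symm U)) := by
    intro U
    rw [← QCDLatticeObservable.axisPerm_onTorus, configPerm_configPerm_symm]
  simp only [h]
  exact qcdTorusExpect_quarkAxisPerm hS β mq (fun U => A.onTorus T v U)

/-- **Two-point functions of permuted observables at permuted sites are the original ones.** [cite: OsterwalderSeiler1978, §2] -/
theorem qcdTorusExpect_axisPerm_onTorus_mul {R' : ℕ} {π : Equiv.Perm (Fin 4)} {S S' : Matrix (Fin 4) (Fin 4) ℂ}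
    (hS : IsSpinorIntertwiner π S S') (β : ℝ) (mq : Fin Nf → ℝ) (A : QCDLatticeObservable Nf R) (B : QCDLatticeObservable Nf R')
    (v w : _root_.Literature.Probability.LatticeModels.Site 4) :
    qcdTorusExpect β T mq (fun U => (A.axisPerm π S S').onTorus T (sitePermZd π v) U *
        (B.axisPerm π S S').onTorus T (sitePermZd π w) U) =
      qcdTorusExpect β T mq (fun U => A.onTorus T v U * B.onTorus T w U) := by
  have h : ∀ (R₀ : ℕ) (C : QCDLatticeObservable Nf R₀) (u : _root_.Literature.Probability.LatticeModels.Site 4)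
      (U : GaugeConfig 4 T 𝔾), (C.axisPerm π S S').onTorus T (sitePermZd π u) U =
      quarkAxisPerm Nf π S S' (C.onTorus T u (configPerm π.symm U)) := by
    intro R₀ C u U
    rw [← QCDLatticeObservable.axisPerm_onTorus, configPerm_configPerm_symm]
  simp only [h, ← map_mul]
  exact qcdTorusExpect_quarkAxisPerm hS β mq (fun U => A.onTorus T v U * B.onTorus T w U)

end Expectations

/-! ### The lattice mass gap along every axis -/

/-- **The uniform lattice mass gap of `QCDOS` holds along every coordinate axis** with the same rate: for every pair of
gauge-invariant local observables `A, B` there is `C` such that eventually in `k`, on every torus `2T+1 ≥ 2L_k+1` and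
for all separations `n ≤ T` along the axis `i`,
`‖⟨A(0) · B(n eᵢ)⟩ − ⟨A(0)⟩⟨B(n eᵢ)⟩‖ ≤ C e^{−Δ a_k n}` (apply the clause to the permuted pair for the transposition
`(0 i)` and transport by `qcdTorusExpect_axisPerm_onTorus(_mul)`). [cite: JaffeWitten2000, §5] [cite: OsterwalderSeiler1978, §§2–4] -/
theorem QCDScheme.HasLatticeMassGap.along_axis {sch : QCDScheme Nf} {Δ : ℝ} (h : sch.HasLatticeMassGap Δ) (i : Fin 4)
    {R R' : ℕ} (A : QCDLatticeObservable Nf R) (B : QCDLatticeObservable Nf R') :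
    ∃ C : ℝ, ∀ᶠ k in Filter.atTop, ∀ T : ℕ, sch.L k ≤ T → ∀ n : ℕ, n ≤ T →
      ‖qcdTorusExpect (sch.β k) (2 * T + 1) (fun fl => sch.mq fl k)
            (fun U => A.onTorus (2 * T + 1) 0 U * B.onTorus (2 * T + 1) (Pi.single i (n : ℤ)) U) -
          qcdTorusExpect (sch.β k) (2 * T + 1) (fun fl => sch.mq fl k) (A.onTorus (2 * T + 1) 0) *
            qcdTorusExpect (sch.β k) (2 * T + 1) (fun fl => sch.mq fl k)
              (B.onTorus (2 * T + 1) (Pi.single i (n : ℤ)))‖ ≤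
        C * Real.exp (-(Δ * (sch.a k * n))) := by
  rcases eq_or_ne i 0 with rfl | hi
  · -- the time axis itself
    obtain ⟨C, hC⟩ := h R R' A B
    exact ⟨C, hC⟩
  · set π : Equiv.Perm (Fin 4) := Equiv.swap 0 i with hπ
    have hS := transpositionSpinor_intertwines hi.symm
    obtain ⟨C, hC⟩ := h R R' (A.axisPerm π (transpositionSpinor 0 i) (transpositionSpinorInv 0 i))
      (B.axisPerm π (transpositionSpinor 0 i) (transpositionSpinorInv 0 i))
    refine ⟨C, ?_⟩
    filter_upwards [hC] with k hk T hT n hn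
    have key := hk T hT n hn
    rw [qcdLatticeConnectedCorr] at key
    have h0 : sitePermZd π (0 : _root_.Literature.Probability.LatticeModels.Site 4) = 0 := sitePermZd_zero π
    have hn' : sitePermZd π (Pi.single i (n : ℤ) : _root_.Literature.Probability.LatticeModels.Site 4) = Pi.single 0 (n : ℤ) := by
      rw [sitePermZd_single, hπ, Equiv.swap_apply_right]
    rw [← h0, ← hn', qcdTorusExpect_axisPerm_onTorus_mul hS,
      show ((A.axisPerm π (transpositionSpinor 0 i) (transpositionSpinorInv 0 i)).onTorus (2 * T + 1) (sitePermZd π 0)) =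
        fun U => (A.axisPerm π (transpositionSpinor 0 i) (transpositionSpinorInv 0 i)).onTorus (2 * T + 1) (sitePermZd π 0) U
        from rfl, qcdTorusExpect_axisPerm_onTorus hS,
      show ((B.axisPerm π (transpositionSpinor 0 i) (transpositionSpinorInv 0 i)).onTorus (2 * T + 1)
          (sitePermZd π (Pi.single i (n : ℤ)))) =
        fun U => (B.axisPerm π (transpositionSpinor 0 i) (transpositionSpinorInv 0 i)).onTorus (2 * T + 1)
          (sitePermZd π (Pi.single i (n : ℤ))) U from rfl, qcdTorusExpect_axisPerm_onTorus hS] at key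
    exact key

end Literature.MathematicalPhysics.QuantumFieldTheory

end
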